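/- Free-seat work of EXTRA WIDTH SEAT `ym-line-cbag-p1-w4` (prover-ym-line-cbag-p1-w4-g2-0), route `EguchiKawaiDirectionLadder`
(ideator ym-idea-2, LINE 8), crux `TripleSmallBallMargin` (stmt-QuantumFields-27724): primitive (W) = stub S3 of the LEAD's architecture
note (ARCH-27724-lead-g24.md §1): the WEYL SUP BOUND.  ROUTE-INDEPENDENT.  Nothing here bears on the Yang–Mills mass gap. -/
import Literature.Probability.RandomMatrix.WeylIntegrationFormulaHolds
import HarnessLib

/-!
# Route `EguchiKawaiDirectionLadder`: the Weyl sup bound (W) / S3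

For a measurable class function `F ≥ 0` on `U(N)` (`F(V U V⁻¹) = F U`), Weyl's integration formula in eigenangle form
(`Literature.Probability.RandomMatrix.weylIntegrationFormulaUN_holds`) and `vol([−π,π]^N) = (2π)^N` give

  `∫ F dHaar_{U(N)} ≤ (N!)⁻¹ · sup_θ ( ∏_{j<k} |e^{iθ_j} − e^{iθ_k}|² · F(diag e^{iθ}) )`       (`lintegral_haar_le_weylSup`)

— the form in which the small-ball books of LINE 8 consume Weyl (`(Ψ) ⇐ (E)+(W)`, `(a′) ⇐ (E)+(W)+(Ψ)`, `(Ψ_rob) ⇐ (E_rob)+(W)`): one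
Tonelli, the Vandermonde weight paired with the fibre bound pointwise, the `(2π)^N` gone.  Also the box volume
`volume_eigenBox : vol([−π,π]^N) = (2π)^N` and the unnormalised form `lintegral_haar_le_const_mul_setLIntegral`.

HONEST FRAMING: a corollary of the tree's PROVED Weyl formula; no small-ball estimate.  The route bears on the barrier-ledger fact
`EguchiKawaiBreakdown` only.
-/

set_option autoImplicit false

noncomputable section

open MeasureTheory Complex
open scoped ENNReal Real

namespace Summit.QuantumFields.YangMills.Theorems.EguchiKawaiDirectionLadder

open Literature.MathematicalPhysics.QuantumFieldTheory (haarProbability)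
open Literature.LinearAlgebra.Matrix (diagonalTorusHom)
open Literature.Probability.RandomMatrix (WeylIntegrationFormulaUN weylIntegrationFormulaUN_holds)

/-- `vol([−π, π]^N) = (2π)^N`. -/
theorem volume_eigenBox (N : ℕ) :
    volume (Set.pi Set.univ fun _ : Fin N => Set.Icc (-π) π) = ENNReal.ofReal (2 * π) ^ N := by
  rw [volume_pi, Measure.pi_pi]
  simp only [Real.volume_Icc, Finset.prod_const, Finset.card_univ, Fintype.card_fin]
  congr 1
  ring_nf

/-- **THE WEYL SUP BOUND (W).**  For a measurable class function `F ≥ 0` on `U(N)`: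
`∫ F dHaar ≤ (N!)⁻¹ · sup_θ ∏_{j<k}|e^{iθ_j} − e^{iθ_k}|² · F(diag e^{iθ})`. -/
theorem lintegral_haar_le_weylSup (N : ℕ) (F : Matrix.unitaryGroup (Fin N) ℂ → ℝ≥0∞) (hF : Measurable F)
    (hcl : ∀ U V : Matrix.unitaryGroup (Fin N) ℂ, F (V * U * V⁻¹) = F U) :
    ∫⁻ U, F U ∂haarProbability (Matrix.unitaryGroup (Fin N) ℂ) ≤
      ((N.factorial : ℝ≥0∞))⁻¹ *
        ⨆ θ : Fin N → ℝ, ENNReal.ofReal (∏ j : Fin N, ∏ k ∈ Finset.Ioi j,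
            ‖cexp (θ j * I) - cexp (θ k * I)‖ ^ 2) * F (diagonalTorusHom (Fin N) fun j => Circle.exp (θ j)) := by
  rw [weylIntegrationFormulaUN_holds N F hF hcl]
  set g : (Fin N → ℝ) → ℝ≥0∞ := fun θ => ENNReal.ofReal (∏ j : Fin N, ∏ k ∈ Finset.Ioi j,
      ‖cexp (θ j * I) - cexp (θ k * I)‖ ^ 2) * F (diagonalTorusHom (Fin N) fun j => Circle.exp (θ j)) with hg
  have hbox : MeasurableSet (Set.pi Set.univ fun _ : Fin N => Set.Icc (-π) π) :=
    MeasurableSet.univ_pi fun _ => measurableSet_Icc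
  -- bound the box integral by `sup · volume`
  have h1 : ∫⁻ θ in Set.pi Set.univ (fun _ : Fin N => Set.Icc (-π) π), g θ ≤
      (⨆ θ, g θ) * ENNReal.ofReal (2 * π) ^ N := by
    calc ∫⁻ θ in Set.pi Set.univ (fun _ : Fin N => Set.Icc (-π) π), g θ
        ≤ (⨆ θ ∈ Set.pi Set.univ (fun _ : Fin N => Set.Icc (-π) π), g θ) *
            volume (Set.pi Set.univ fun _ : Fin N => Set.Icc (-π) π) := setLIntegral_le_iSup_mul g hbox
      _ ≤ (⨆ θ, g θ) * ENNReal.ofReal (2 * π) ^ N := by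
          rw [volume_eigenBox]
          exact mul_le_mul_left (iSup₂_le fun θ _ => le_iSup g θ) _
  -- constants: `((2π)^N N!)⁻¹ · (2π)^N = (N!)⁻¹`
  have h2pi : ENNReal.ofReal (2 * π) ≠ 0 := by
    rw [ENNReal.ofReal_ne_zero_iff]; exact Real.two_pi_pos
  have hconst : ENNReal.ofReal (((2 * π) ^ N * (N.factorial : ℝ))⁻¹) * ENNReal.ofReal (2 * π) ^ N =
      ((N.factorial : ℝ≥0∞))⁻¹ := by
    rw [ENNReal.ofReal_inv_of_pos (by positivity), ENNReal.ofReal_mul (by positivity),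
      ENNReal.ofReal_pow Real.two_pi_pos.le, ENNReal.ofReal_natCast,
      ENNReal.mul_inv (Or.inl (pow_ne_zero _ h2pi)) (Or.inl (ENNReal.pow_ne_top ENNReal.ofReal_ne_top)),
      mul_comm, ← mul_assoc, ENNReal.mul_inv_cancel (pow_ne_zero _ h2pi) (ENNReal.pow_ne_top ENNReal.ofReal_ne_top),
      one_mul]
  calc ENNReal.ofReal (((2 * π) ^ N * (N.factorial : ℝ))⁻¹) *
        ∫⁻ θ in Set.pi Set.univ (fun _ : Fin N => Set.Icc (-π) π), g θ
      ≤ ENNReal.ofReal (((2 * π) ^ N * (N.factorial : ℝ))⁻¹) * ((⨆ θ, g θ) * ENNReal.ofReal (2 * π) ^ N) := by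
        gcongr
    _ = ((N.factorial : ℝ≥0∞))⁻¹ * ⨆ θ, g θ := by
        rw [mul_comm (⨆ θ, g θ), ← mul_assoc, hconst]

/-- Pointwise-bound form: if `∏_{j<k}|e^{iθ_j} − e^{iθ_k}|² · F(diag e^{iθ}) ≤ M` for every `θ`, then `∫ F dHaar ≤ M / N!`. -/
theorem lintegral_haar_le_of_weylSup_le (N : ℕ) (F : Matrix.unitaryGroup (Fin N) ℂ → ℝ≥0∞) (hF : Measurable F)
    (hcl : ∀ U V : Matrix.unitaryGroup (Fin N) ℂ, F (V * U * V⁻¹) = F U) (M : ℝ≥0∞)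
    (hM : ∀ θ : Fin N → ℝ, ENNReal.ofReal (∏ j : Fin N, ∏ k ∈ Finset.Ioi j,
        ‖cexp (θ j * I) - cexp (θ k * I)‖ ^ 2) * F (diagonalTorusHom (Fin N) fun j => Circle.exp (θ j)) ≤ M) :
    ∫⁻ U, F U ∂haarProbability (Matrix.unitaryGroup (Fin N) ℂ) ≤ ((N.factorial : ℝ≥0∞))⁻¹ * M :=
  (lintegral_haar_le_weylSup N F hF hcl).trans (by gcongr; exact iSup_le hM)

end Summit.QuantumFields.YangMills.Theorems.EguchiKawaiDirectionLadder

end
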